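import Literature.Barriers.AtomisticToContinuum.NoBVEstimatesMultiDLinearizedSolution
import Literature.Analysis.FunctionSpaces.PlancherelL1L2
import Mathlib.Algebra.QuadraticDiscriminant
import HarnessLib

/-!
# Lemmas for the `L²` small-amplitude expansion: Duhamel's formula on the Fourier side,
quadratic Taylor bounds, Cauchy–Schwarz in time, Plancherel for `ℂᵏ`-valued fields

Second brick of the programme to discharge `Rauch1986_smallAmplitudeExpansionL2`
(`NoBVEstimatesMultiDSmallAmplitude.lean`): the generic tools used by
`NoBVEstimatesMultiDExpansion.lean` to bound the remainder `r_ε = u_ε - ū - εv` of Rauch's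
expansion [Rauch1986, Proof of Theorem p. 482] by Duhamel's principle for the linearised
constant-coefficient system on the Fourier side.

* `duhamel_mulVec` — variation of constants for `W' = -GW + h` on `[0, T]` in `ℂᵏ`:
  `e^{TG}W(T) - W(0) = ∫₀ᵀ e^{sG}h(s) ds` (continuity on `[0, T]`, the equation at interior
  times);
* `exists_quadratic_bounds_of_fderiv_zero` — a `C²` map `Φ` on a finite-dimensional space with
  `Φ(0) = 0`, `DΦ(0) = 0` satisfies `‖Φ(y)‖ ≤ C‖y‖²`, `‖DΦ(y)‖ ≤ C‖y‖` on a ball (mean value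
  inequality twice);
* `sq_integral_le_mul_integral_sq` — `(∫₀ᵀ a)² ≤ T ∫₀ᵀ a²` (the discriminant of
  `λ ↦ ∫₀ᵀ (λ - a)² ≥ 0`);
* `toEuc`, `integral_norm_sq_fourier_le`, `integral_norm_sq_le_fourier` — Plancherel
  [Titchmarsh, Thm. 48] for continuous compactly supported `ℂᵏ`-valued fields with the sup
  norm on `ℂᵏ`, through `EuclideanSpace ℂ (Fin k)` and the tree's
  `Literature.Analysis.FunctionSpaces.integral_norm_sq_fourierIntegral_eq`, at the price of the
  factor `k`: `∫‖𝓕g‖²_∞ ≤ k∫‖g‖²_∞` and `∫‖g‖²_∞ ≤ k∫‖𝓕g‖²_∞`;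
* `constCoeffOp`, `fourier_cplx_constCoeffOp`, `fourier_cplx_eq_of_constCoeffOp` — the
  constant-coefficient operator on the Fourier side:
  `𝓕[(A₀h + Σ Aⱼ∂ⱼg + B₁g)_ℂ] = A₀_ℂ 𝓕h_ℂ + (Σ 2πiξⱼAⱼ,ℂ + B₁,ℂ) 𝓕g_ℂ`, i.e.
  `𝓕h_ℂ = -G 𝓕g_ℂ + A₀⁻¹_ℂ 𝓕[…]` with `G = rauchGenerator A₀ A B₁`, for `g ∈ C¹_c`, `h ∈ C_c`.

Everything is proved; no named fact and no `sorry` is introduced.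

## References

* [Rauch1986] J. Rauch, Comm. Math. Phys. 106 (1986) 481–484, Proof of Theorem pp. 482–483.
* [Brenner1973] P. Brenner, Ark. Mat. 11 (1973) 75–101, Lemma 5.1 p. 96 (the Fourier-side ODE).
* E. C. Titchmarsh, *Introduction to the Theory of Fourier Integrals* (1948), Thm. 48.
* J. Dieudonné, *Foundations of Modern Analysis* (1960), (8.6.2) (Taylor with remainder of
  order two via the mean value theorem).
-/

noncomputable section

open MeasureTheory Set Filter Matrix FourierTransform Metric Complex intervalIntegral
open scoped ENNReal NNReal ContDiff Topology RealInnerProductSpace Matrix.Norms.Operator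

namespace Literature.Barriers.AtomisticToContinuum

open Literature.Analysis.Fourier Literature.Analysis.FluidPDE Literature.Analysis.Calculus
  Literature.Analysis.FunctionSpaces QuasilinearSystem

variable {d k : ℕ}

/-! ### Duhamel's formula for `W' = -GW + h` in `ℂᵏ` -/

/-- The exponential `e^{sG}` commutes with `G`. [folklore] -/
theorem exp_smul_mul_comm (G : Matrix (Fin k) (Fin k) ℂ) (s : ℝ) :
    NormedSpace.exp (s • G) * G = G * NormedSpace.exp (s • G) :=
  (((Commute.refl G).smul_left s).exp_left).eq

/-- **Duhamel's formula (variation of constants) on `[0, T]`**: if `W` is continuous on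
`[0, T]` with `W'(t) = -GW(t) + h(t)` at interior times and `s ↦ e^{sG}h(s)` is interval
integrable, then `e^{TG}W(T) - W(0) = ∫₀ᵀ e^{sG}h(s) ds` — `z(s) = e^{sG}W(s)` has derivative
`e^{sG}h(s)` on `(0, T)` (the terms `e^{sG}GW - e^{sG}GW` cancelling), and the fundamental
theorem of calculus applies. [cite: Brenner1973, Lemma 5.1 (5.12) p. 96] -/
theorem duhamel_mulVec {W h : ℝ → Fin k → ℂ} {G : Matrix (Fin k) (Fin k) ℂ} {T : ℝ} (hT : 0 ≤ T)
    (hWc : ContinuousOn W (Icc 0 T))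
    (hWd : ∀ t ∈ Ioo 0 T, HasDerivAt W (-(G *ᵥ W t) + h t) t)
    (hint : IntervalIntegrable (fun s => NormedSpace.exp (s • G) *ᵥ h s) volume 0 T) :
    NormedSpace.exp (T • G) *ᵥ W T - W 0 = ∫ s in (0 : ℝ)..T, NormedSpace.exp (s • G) *ᵥ h s := by
  set z : ℝ → Fin k → ℂ := fun s => NormedSpace.exp (s • G) *ᵥ W s with hz
  have hexpd : ∀ s : ℝ, HasDerivAt (fun s : ℝ => mulVecBilin (NormedSpace.exp (s • G)))
      (mulVecBilin (G * NormedSpace.exp (s • G))) s := fun s =>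
    mulVecBilin.hasFDerivAt.comp_hasDerivAt s (hasDerivAt_exp_smul_const' (𝕂 := ℝ) G s)
  have hzd : ∀ s ∈ Ioo 0 T, HasDerivAt z (NormedSpace.exp (s • G) *ᵥ h s) s := by
    intro s hs
    have h1 := (hexpd s).clm_apply (hWd s hs)
    have hval : mulVecBilin (G * NormedSpace.exp (s • G)) (W s) +
        mulVecBilin (NormedSpace.exp (s • G)) (-(G *ᵥ W s) + h s) =
        NormedSpace.exp (s • G) *ᵥ h s := by
      rw [Literature.Analysis.Fourier.mulVecBilin_apply, Literature.Analysis.Fourier.mulVecBilin_apply,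
        ← exp_smul_mul_comm, mulVec_add, mulVec_neg, ← mulVec_mulVec]
      abel
    rw [hval] at h1
    exact h1
  have hexpc : Continuous fun s : ℝ => NormedSpace.exp (s • G) :=
    NormedSpace.exp_continuous.comp (continuous_id.smul continuous_const)
  have hzc : ContinuousOn z (Icc 0 T) :=
    (mulVecBilin.continuous₂.comp_continuousOn (hexpc.continuousOn.prodMk hWc) :)
  have h := integral_eq_sub_of_hasDerivAt_of_le hT hzc hzd hint
  rw [h, hz]
  simp only [zero_smul, NormedSpace.exp_zero, one_mulVec]

/-! ### Quadratic Taylor bounds from `Φ(0) = 0`, `DΦ(0) = 0` -/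

/-- **Second-order vanishing at the origin**: a `C²` map `Φ : E → F` with `Φ(0) = 0` and
`DΦ(0) = 0` satisfies, on a ball `‖y‖ ≤ r`, `‖DΦ(y)‖ ≤ C‖y‖` and `‖Φ(y)‖ ≤ C‖y‖²`, with `C`
a Lipschitz constant of `DΦ` near `0` (mean value inequality for `Φ` on the ball of radius
`‖y‖`). [folklore] -/
theorem exists_quadratic_bounds_of_fderiv_zero {E F : Type*} [NormedAddCommGroup E]
    [NormedSpace ℝ E] [NormedAddCommGroup F] [NormedSpace ℝ F]
    {Φ : E → F} (hΦ : ContDiff ℝ 2 Φ) (h0 : Φ 0 = 0) (hD0 : fderiv ℝ Φ 0 = 0) :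
    ∃ C r : ℝ, 0 ≤ C ∧ 0 < r ∧ ∀ y : E, ‖y‖ ≤ r →
      ‖fderiv ℝ Φ y‖ ≤ C * ‖y‖ ∧ ‖Φ y‖ ≤ C * ‖y‖ ^ 2 := by
  -- `DΦ` is `C¹`, hence Lipschitz near `0`
  have hD : ContDiff ℝ 1 (fderiv ℝ Φ) := hΦ.fderiv_right (m := 1) (by norm_num)
  obtain ⟨K, t, ht, hK⟩ := (hD.contDiffAt (x := 0)).exists_lipschitzOnWith
  obtain ⟨r, hr, hrt⟩ := Metric.mem_nhds_iff.1 ht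
  refine ⟨K, r / 2, K.2, by positivity, fun y hy => ?_⟩
  have hyr : ∀ z : E, ‖z‖ ≤ ‖y‖ → z ∈ t := fun z hz =>
    hrt (mem_ball_zero_iff.2 (lt_of_le_of_lt (hz.trans hy) (by linarith)))
  -- first bound: the Lipschitz estimate for `DΦ` between `0` and `z`
  have hbound : ∀ z : E, ‖z‖ ≤ ‖y‖ → ‖fderiv ℝ Φ z‖ ≤ K * ‖z‖ := by
    intro z hz
    have h := hK.norm_sub_le (hyr z hz) (hyr 0 (by simp))
    rwa [hD0, sub_zero, sub_zero] at h
  refine ⟨hbound y le_rfl, ?_⟩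
  -- second bound: mean value inequality for `Φ` on the ball of radius `‖y‖`
  have hbound' : ∀ z ∈ closedBall (0 : E) ‖y‖, ‖fderiv ℝ Φ z‖ ≤ K * ‖y‖ := by
    intro z hz
    have hz' : ‖z‖ ≤ ‖y‖ := mem_closedBall_zero_iff.1 hz
    exact (hbound z hz').trans (mul_le_mul_of_nonneg_left hz' K.2)
  have h := (convex_closedBall (0 : E) ‖y‖).norm_image_sub_le_of_norm_fderiv_le (f := Φ)
    (fun x _ => (hΦ.differentiable (by norm_num)).differentiableAt) hbound'
    (mem_closedBall_self (norm_nonneg y)) (mem_closedBall_zero_iff.2 le_rfl)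
  rw [h0, sub_zero, sub_zero] at h
  calc ‖Φ y‖ ≤ K * ‖y‖ * ‖y‖ := h
    _ = K * ‖y‖ ^ 2 := by ring

/-! ### Cauchy–Schwarz in time -/

/-- **`(∫₀ᵀ a)² ≤ T ∫₀ᵀ a²`** for an interval integrable `a` with `a²` interval integrable and
`0 ≤ T`: the quadratic `λ ↦ ∫₀ᵀ (λ - a(s))² ds = Tλ² - 2λ∫a + ∫a² ≥ 0` has nonpositive
discriminant. [folklore] -/
theorem sq_integral_le_mul_integral_sq {a : ℝ → ℝ} {T : ℝ} (hT : 0 ≤ T)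
    (ha : IntervalIntegrable a volume 0 T) (ha2 : IntervalIntegrable (fun s => a s ^ 2) volume 0 T) :
    (∫ s in (0 : ℝ)..T, a s) ^ 2 ≤ T * ∫ s in (0 : ℝ)..T, a s ^ 2 := by
  have hquad : ∀ x : ℝ, 0 ≤ T * (x * x) + (-2 * ∫ s in (0 : ℝ)..T, a s) * x +
      ∫ s in (0 : ℝ)..T, a s ^ 2 := by
    intro x
    have hnn : 0 ≤ ∫ s in (0 : ℝ)..T, (x - a s) ^ 2 :=
      intervalIntegral.integral_nonneg hT fun s _ => sq_nonneg _
    have hexp : ∫ s in (0 : ℝ)..T, (x - a s) ^ 2 =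
        T * (x * x) + (-2 * ∫ s in (0 : ℝ)..T, a s) * x + ∫ s in (0 : ℝ)..T, a s ^ 2 := by
      have hfun : (fun s => (x - a s) ^ 2) = fun s => (x ^ 2 - (2 * x) * a s) + a s ^ 2 := by
        funext s; ring
      rw [hfun, intervalIntegral.integral_add ((intervalIntegrable_const.sub (ha.const_mul _)))
        ha2, intervalIntegral.integral_sub intervalIntegrable_const (ha.const_mul _),
        intervalIntegral.integral_const, intervalIntegral.integral_const_mul]
      simp only [sub_zero, smul_eq_mul]
      ring
    rw [← hexp]
    exact hnn
  have hdisc := discrim_le_zero hquad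
  rw [discrim] at hdisc
  nlinarith [hdisc]

/-! ### Plancherel for `ℂᵏ`-valued fields with the sup norm -/

/-- `ℂᵏ` with the sup norm into `EuclideanSpace ℂ (Fin k)`, as a continuous linear map
(the identity on coordinates). [folklore] -/
def toEuc : (Fin k → ℂ) →L[ℂ] EuclideanSpace ℂ (Fin k) :=
  ((EuclideanSpace.equiv (Fin k) ℂ).symm : (Fin k → ℂ) →L[ℂ] EuclideanSpace ℂ (Fin k))

/-- Coordinates are unchanged: `(toEuc y) i = y i`. [folklore] -/
@[simp] theorem toEuc_apply (y : Fin k → ℂ) (i : Fin k) : toEuc y i = y i := rfl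

/-- `‖toEuc y‖² = Σᵢ |yᵢ|²`. [folklore] -/
theorem norm_toEuc_sq (y : Fin k → ℂ) : ‖toEuc y‖ ^ 2 = ∑ i, ‖y i‖ ^ 2 := by
  rw [EuclideanSpace.norm_sq_eq]
  rfl

/-- **The sup norm is dominated by the Euclidean norm**: `‖y‖_∞ ≤ ‖toEuc y‖`. [folklore] -/
theorem norm_le_norm_toEuc (y : Fin k → ℂ) : ‖y‖ ≤ ‖toEuc y‖ := by
  refine (pi_norm_le_iff_of_nonneg (norm_nonneg _)).2 fun i => ?_
  have h1 : ‖y i‖ ^ 2 ≤ ‖toEuc y‖ ^ 2 := by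
    rw [norm_toEuc_sq]
    exact Finset.single_le_sum (f := fun j => ‖y j‖ ^ 2) (fun j _ => sq_nonneg _)
      (Finset.mem_univ i)
  exact (pow_le_pow_iff_left₀ (norm_nonneg _) (norm_nonneg _) two_ne_zero).1 h1

/-- **The Euclidean norm is dominated by `√k` times the sup norm**: `‖toEuc y‖² ≤ k‖y‖²_∞`.
[folklore] -/
theorem norm_toEuc_sq_le (y : Fin k → ℂ) : ‖toEuc y‖ ^ 2 ≤ k * ‖y‖ ^ 2 := by
  rw [norm_toEuc_sq]
  calc ∑ i, ‖y i‖ ^ 2 ≤ ∑ _i : Fin k, ‖y‖ ^ 2 :=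
        Finset.sum_le_sum fun i _ => pow_le_pow_left₀ (norm_nonneg _) (norm_le_pi_norm y i) 2
    _ = k * ‖y‖ ^ 2 := by
        rw [Finset.sum_const, Finset.card_univ, Fintype.card_fin, nsmul_eq_mul]

/-- The Fourier integral commutes with `toEuc`: `𝓕(toEuc ∘ g)(ξ) = toEuc (𝓕g(ξ))`. [folklore] -/
theorem fourier_toEuc_comp {g : Space d → Fin k → ℂ} (hg : Integrable g) (ξ : Space d) :
    𝓕 (fun x => toEuc (g x)) ξ = toEuc (𝓕 g ξ) := by
  rw [Real.fourier_eq, Real.fourier_eq, ← ContinuousLinearMap.integral_comp_comm toEuc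
    ((Real.fourierIntegral_convergent_iff ξ).2 hg)]
  refine integral_congr_ae (Eventually.of_forall fun x => ?_)
  simp only [Circle.smul_def, map_smul]

/-- The Fourier integral of an integrable field is continuous. [folklore] -/
theorem continuous_fourier_of_integrable {g : Space d → Fin k → ℂ} (hg : Integrable g) :
    Continuous (𝓕 g) :=
  VectorFourier.fourierIntegral_continuous Real.continuous_fourierChar
    (innerSL ℝ).continuous₂ hg

/-- `‖g‖²_∞` is integrable for a continuous compactly supported field. [folklore] -/
theorem integrable_norm_sq_of_hasCompactSupport {g : Space d → Fin k → ℂ} (hg : Continuous g)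
    (hc : HasCompactSupport g) : Integrable fun x => ‖g x‖ ^ 2 := by
  refine (hg.norm.pow 2).integrable_of_hasCompactSupport ?_
  refine HasCompactSupport.intro hc fun x hx => ?_
  have hx0 := image_eq_zero_of_notMem_tsupport hx
  simp [hx0]

/-- **Plancherel through `EuclideanSpace ℂ (Fin k)`**: for a continuous compactly supported
`ℂᵏ`-valued field `g`, `‖𝓕(toEuc ∘ g)‖²` and `‖toEuc ∘ g‖²` are integrable with equal
integrals, and `𝓕(toEuc ∘ g) = toEuc ∘ 𝓕g`. [cite: Titchmarsh1948, Thm. 48] -/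
theorem plancherel_toEuc {g : Space d → Fin k → ℂ} (hg : Continuous g) (hc : HasCompactSupport g) :
    Integrable (fun ξ => ‖toEuc (𝓕 g ξ)‖ ^ 2) ∧ Integrable (fun x => ‖toEuc (g x)‖ ^ 2) ∧
      ∫ ξ, ‖toEuc (𝓕 g ξ)‖ ^ 2 = ∫ x, ‖toEuc (g x)‖ ^ 2 := by
  have hgi : Integrable g := hg.integrable_of_hasCompactSupport hc
  set ge : Space d → EuclideanSpace ℂ (Fin k) := fun x => toEuc (g x) with hge
  have hgec : Continuous ge := toEuc.continuous.comp hg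
  have hgecs : HasCompactSupport ge := hc.comp_left (map_zero toEuc)
  have hge1 : Integrable ge := hgec.integrable_of_hasCompactSupport hgecs
  have hge2 : MemLp ge 2 := hgec.memLp_of_hasCompactSupport hgecs
  have hP := integral_norm_sq_fourierIntegral_eq hge1 hge2
  have hFe : ∀ ξ, 𝓕 ge ξ = toEuc (𝓕 g ξ) := fun ξ => fourier_toEuc_comp hgi ξ
  have hFi2 : Integrable fun ξ => ‖𝓕 ge ξ‖ ^ 2 := by
    have h := memLp_two_fourierIntegral hge1 hge2
    exact (memLp_two_iff_integrable_sq_norm h.1).1 h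
  have hge_sq : Integrable fun x => ‖ge x‖ ^ 2 := (memLp_two_iff_integrable_sq_norm hge2.1).1 hge2
  refine ⟨?_, hge_sq, ?_⟩
  · have : (fun ξ => ‖𝓕 ge ξ‖ ^ 2) = fun ξ => ‖toEuc (𝓕 g ξ)‖ ^ 2 :=
      funext fun ξ => by rw [hFe ξ]
    rw [← this]; exact hFi2
  · have : (fun ξ => ‖𝓕 ge ξ‖ ^ 2) = fun ξ => ‖toEuc (𝓕 g ξ)‖ ^ 2 :=
      funext fun ξ => by rw [hFe ξ]
    rw [← this]; exact hP

/-- **Plancherel, upper bound for the transform**: for a continuous compactly supported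
`ℂᵏ`-valued field, `‖𝓕g‖²_∞` is integrable and `∫ ‖𝓕g(ξ)‖²_∞ dξ ≤ k ∫ ‖g(x)‖²_∞ dx`.
[cite: Titchmarsh1948, Thm. 48] -/
theorem integral_norm_sq_fourier_le {g : Space d → Fin k → ℂ} (hg : Continuous g)
    (hc : HasCompactSupport g) :
    Integrable (fun ξ => ‖𝓕 g ξ‖ ^ 2) ∧ ∫ ξ, ‖𝓕 g ξ‖ ^ 2 ≤ k * ∫ x, ‖g x‖ ^ 2 := by
  obtain ⟨hF2, hg2, hP⟩ := plancherel_toEuc hg hc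
  have hgi : Integrable g := hg.integrable_of_hasCompactSupport hc
  have hFc : Continuous (𝓕 g) := continuous_fourier_of_integrable hgi
  have hdom : ∀ ξ, ‖𝓕 g ξ‖ ^ 2 ≤ ‖toEuc (𝓕 g ξ)‖ ^ 2 := fun ξ =>
    pow_le_pow_left₀ (norm_nonneg _) (norm_le_norm_toEuc _) 2
  have hint : Integrable fun ξ => ‖𝓕 g ξ‖ ^ 2 :=
    hF2.mono' ((hFc.norm.pow 2).aestronglyMeasurable)
      (Eventually.of_forall fun ξ => by
        rw [Real.norm_eq_abs, abs_of_nonneg (sq_nonneg _)]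
        exact hdom ξ)
  refine ⟨hint, ?_⟩
  have hg_sq := integrable_norm_sq_of_hasCompactSupport hg hc
  calc ∫ ξ, ‖𝓕 g ξ‖ ^ 2 ≤ ∫ ξ, ‖toEuc (𝓕 g ξ)‖ ^ 2 := integral_mono hint hF2 hdom
    _ = ∫ x, ‖toEuc (g x)‖ ^ 2 := hP
    _ ≤ ∫ x, k * ‖g x‖ ^ 2 := integral_mono hg2 (hg_sq.const_mul _) fun x => norm_toEuc_sq_le (g x)
    _ = k * ∫ x, ‖g x‖ ^ 2 := integral_const_mul _ _

/-- **Plancherel, upper bound for the field**: for a continuous compactly supported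
`ℂᵏ`-valued field, `∫ ‖g(x)‖²_∞ dx ≤ k ∫ ‖𝓕g(ξ)‖²_∞ dξ`. [cite: Titchmarsh1948, Thm. 48] -/
theorem integral_norm_sq_le_fourier {g : Space d → Fin k → ℂ} (hg : Continuous g)
    (hc : HasCompactSupport g) :
    ∫ x, ‖g x‖ ^ 2 ≤ k * ∫ ξ, ‖𝓕 g ξ‖ ^ 2 := by
  obtain ⟨hF2, hg2, hP⟩ := plancherel_toEuc hg hc
  have hg_sq := integrable_norm_sq_of_hasCompactSupport hg hc
  have hF_sq := (integral_norm_sq_fourier_le hg hc).1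
  calc ∫ x, ‖g x‖ ^ 2 ≤ ∫ x, ‖toEuc (g x)‖ ^ 2 := integral_mono hg_sq hg2
        fun x => pow_le_pow_left₀ (norm_nonneg _) (norm_le_norm_toEuc _) 2
    _ = ∫ ξ, ‖toEuc (𝓕 g ξ)‖ ^ 2 := hP.symm
    _ ≤ ∫ ξ, k * ‖𝓕 g ξ‖ ^ 2 := integral_mono hF2 (hF_sq.const_mul _) fun ξ => norm_toEuc_sq_le _
    _ = k * ∫ ξ, ‖𝓕 g ξ‖ ^ 2 := integral_const_mul _ _

/-! ### The constant-coefficient operator on the Fourier side -/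

section ConstCoeff

variable {A₀ : Matrix (Fin k) (Fin k) ℝ} {A : Fin d → Matrix (Fin k) (Fin k) ℝ}
  {B₁ : (Fin k → ℝ) →L[ℝ] (Fin k → ℝ)}

variable (A₀ A B₁) in
/-- The constant-coefficient operator `A₀h + Σⱼ Aⱼ∂ⱼg + B₁g` applied to the pair
`(g, h)` (`h` in place of the time derivative). [cite: Rauch1986, (4) p. 482] -/
def constCoeffOp (g h : Space d → Fin k → ℝ) (x : Space d) : Fin k → ℝ :=
  A₀ *ᵥ h x + ∑ j, A j *ᵥ fderiv ℝ g x (EuclideanSpace.single j 1) + B₁ (g x)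

/-- **The constant-coefficient operator on the Fourier side**: for `g ∈ C¹_c`, `h ∈ C_c`,
`𝓕[(A₀h + Σ Aⱼ∂ⱼg + B₁g)_ℂ](ξ) = A₀_ℂ 𝓕h_ℂ(ξ) + (Σⱼ 2πiξⱼ (Aⱼ)_ℂ + (B₁)_ℂ) 𝓕g_ℂ(ξ)`.
[cite: Rauch1986, Proof of Theorem p. 483; Brenner1973, Lemma 5.1 p. 96] -/
theorem fourier_cplx_constCoeffOp {g h : Space d → Fin k → ℝ} (hg : ContDiff ℝ 1 g)
    (hgc : HasCompactSupport g) (hh : Continuous h) (hhc : HasCompactSupport h) (ξ : Space d) :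
    𝓕 (cplx (constCoeffOp A₀ A B₁ g h)) ξ =
      A₀.map (algebraMap ℝ ℂ) *ᵥ 𝓕 (cplx h) ξ +
        (∑ j, (2 * Real.pi * ξ j * Complex.I) • (A j).map (algebraMap ℝ ℂ) +
          (bMatrix B₁).map (algebraMap ℝ ℂ)) *ᵥ 𝓕 (cplx g) ξ := by
  set c := algebraMap ℝ ℂ with hc
  have hgC : ContDiff ℝ 1 (cplx g) := hg.cplx
  have hgCc : HasCompactSupport (cplx g) := hgc.cplx
  have hgi : Integrable (cplx g) := hgC.continuous.integrable_of_hasCompactSupport hgCc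
  have hhC : Continuous (cplx h) := ofRealPi.continuous.comp hh
  have hhi : Integrable (cplx h) := hhC.integrable_of_hasCompactSupport hhc.cplx
  -- the complexified operator
  have hfun : cplx (constCoeffOp A₀ A B₁ g h) = fun x => A₀.map c *ᵥ cplx h x +
      ∑ j, (A j).map c *ᵥ fderiv ℝ (cplx g) x (EuclideanSpace.single j 1) +
        (bMatrix B₁).map c *ᵥ cplx g x := by
    funext x
    have hgd : DifferentiableAt ℝ g x := (hg.differentiable one_ne_zero).differentiableAt
    rw [cplx_apply, constCoeffOp, map_add, map_add, map_sum, ofRealPi_mulVec, ← bMatrix_mulVec,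
      ofRealPi_mulVec]
    simp_rw [ofRealPi_mulVec, ← fderiv_cplx_apply hgd]
    rfl
  rw [hfun]
  -- integrability of the three kinds of terms
  have h1i : Integrable fun x => A₀.map c *ᵥ cplx h x := (mulVecCLM (A₀.map c)).integrable_comp hhi
  have hDji : ∀ j : Fin d, Integrable fun x => fderiv ℝ (cplx g) x (EuclideanSpace.single j 1) := by
    intro j
    refine ((hgC.continuous_fderiv one_ne_zero).clm_apply continuous_const).integrable_of_hasCompactSupport ?_
    exact (hgCc.fderiv ℝ).mono fun x hx => by
      simp only [Function.mem_support, ne_eq] at hx ⊢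
      intro h0
      exact hx (by rw [h0]; rfl)
  have h2i : ∀ j : Fin d, Integrable fun x =>
      (A j).map c *ᵥ fderiv ℝ (cplx g) x (EuclideanSpace.single j 1) :=
    fun j => (mulVecCLM ((A j).map c)).integrable_comp (hDji j)
  have h3i : Integrable fun x => (bMatrix B₁).map c *ᵥ cplx g x :=
    (mulVecCLM ((bMatrix B₁).map c)).integrable_comp hgi
  have h12i : Integrable fun x => A₀.map c *ᵥ cplx h x +
      ∑ j, (A j).map c *ᵥ fderiv ℝ (cplx g) x (EuclideanSpace.single j 1) :=
    h1i.add (integrable_finsetSum _ fun j _ => h2i j)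
  rw [fourier_add_apply h12i h3i,
    fourier_add_apply h1i (integrable_finsetSum _ fun j _ => h2i j), fourier_finset_sum_apply h2i]
  have hF1 : 𝓕 (fun x => A₀.map c *ᵥ cplx h x) ξ = A₀.map c *ᵥ 𝓕 (cplx h) ξ :=
    congr_fun (fourier_mulVec (A₀.map c) hhi) ξ
  have hF2 : ∀ j, 𝓕 (fun x => (A j).map c *ᵥ fderiv ℝ (cplx g) x (EuclideanSpace.single j 1)) ξ =
      (A j).map c *ᵥ ((2 * Real.pi * ξ j * Complex.I) • 𝓕 (cplx g) ξ) := by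
    intro j
    rw [congr_fun (fourier_mulVec ((A j).map c) (hDji j)) ξ, fourier_fderiv_apply_single hgC hgCc ξ j]
  have hF3 : 𝓕 (fun x => (bMatrix B₁).map c *ᵥ cplx g x) ξ = (bMatrix B₁).map c *ᵥ 𝓕 (cplx g) ξ :=
    congr_fun (fourier_mulVec ((bMatrix B₁).map c) hgi) ξ
  rw [hF1, hF3]
  simp_rw [hF2]
  rw [add_mulVec, Matrix.sum_mulVec, add_assoc]
  congr 1
  congr 1
  refine Finset.sum_congr rfl fun j _ => ?_
  rw [smul_mulVec, mulVec_smul]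

/-- **Solving for the time-derivative slot**: with `A₀` invertible,
`𝓕h_ℂ(ξ) = -G(ξ) 𝓕g_ℂ(ξ) + A₀⁻¹_ℂ 𝓕[(A₀h + Σ Aⱼ∂ⱼg + B₁g)_ℂ](ξ)`,
`G = rauchGenerator A₀ A B₁`. [cite: Brenner1973, Lemma 5.1 p. 96] -/
theorem fourier_cplx_eq_of_constCoeffOp (hdet : A₀.det ≠ 0) {g h : Space d → Fin k → ℝ}
    (hg : ContDiff ℝ 1 g) (hgc : HasCompactSupport g) (hh : Continuous h)
    (hhc : HasCompactSupport h) (ξ : Space d) :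
    𝓕 (cplx h) ξ = -(rauchGenerator A₀ A B₁ ξ *ᵥ 𝓕 (cplx g) ξ) +
      (A₀⁻¹).map (algebraMap ℝ ℂ) *ᵥ 𝓕 (cplx (constCoeffOp A₀ A B₁ g h)) ξ := by
  set c := algebraMap ℝ ℂ with hc
  have hinv : (A₀⁻¹).map c * A₀.map c = 1 := by
    rw [← Matrix.map_mul, nonsing_inv_mul _ (isUnit_iff_ne_zero.2 hdet),
      Matrix.map_one c (map_zero c) (map_one c)]
  rw [fourier_cplx_constCoeffOp hg hgc hh hhc ξ, mulVec_add, mulVec_mulVec, hinv, one_mulVec,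
    mulVec_mulVec, ← map_A0_mul_rauchGenerator hdet ξ, ← Matrix.mul_assoc, hinv, Matrix.one_mul]
  abel

end ConstCoeff

end Literature.Barriers.AtomisticToContinuum

end
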